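import Literature.AlgebraicGeometry.Motives.LinesGenerateChowOneRationalChains
import Literature.AlgebraicGeometry.Motives.LinesGenerateChowOneAlgebraicReduction
import Literature.RingTheory.MvPolynomial.LineChainsBoundedDegree
import HarnessLib

/-!
# A UNIFORM positive integer multiplies `CH₁(X)` into the subgroup generated by lines, for every `X = V₊(F) ⊆ ℙᴺ` with `Σ deg Fₐ ≤ N - 1`

Z. Tian, H. R. Zong, *One-cycles on rationally connected varieties*, Compositio Math. **150** (2014)
[TianZong2014], proof of Thm. 6.1 (= Thm. 1.7, the named fact
`TianZong2014_chowOne_generatedByLines`), second bullet: "The cokernel of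
`CH₀(F(X))_alg → CH₁(X)_alg` is annihilated by an integer `N` (c.f. Proposition 3.1)", where
Prop. 3.1 (= Kollár, *Rational Curves on Algebraic Varieties*, IV.3.13.3, "the existence of the
number `N` follows from the argument there but is not explicitly stated") gives ONE positive integer
`N` with `N · D ∼ Σ mᵢ u_*(Fᵢ)` for EVERY `1`-cycle `D`. This file proves that uniform statement for
chains of lines on `X = V₊(F₁, …, F_c) ⊆ ℙᴺ_k` (`k` algebraically closed, `Σ deg Fₐ + 1 ≤ N`, `X`
any closed subscheme with that underlying set):

* `exists_uniform_pos_smul_mem_closure_lineClasses_of_sum_deg_le` — **there is `Nu > 0` with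
  `Nu • x ∈ ⟨line classes⟩` for every `x ∈ CH₁(X)`**; the non-uniform version (an integer depending
  on the class) is `exists_pos_smul_mem_closure_lineClasses_of_sum_deg_le`
  (`Motives/LinesGenerateChowOneRationalAll`).

Proof. `Literature.RingTheory.MvPolynomial.exists_chain_finrank_bound` (spreading out over the
Noetherian chart rings of the chain scheme, `BoundedSolutionDegree`) bounds by some `Bd` the degree
`[E : K]` of a field of definition `E` of a chain of lines joining any two `K`-points of `V(F)`,
for every field `K ⊇ k`. For an integral curve `C ⊆ X` with function field `K`, Tian–Zong's
product trick over the normalisation `Z` of `C` in `E` (`K(Z) ≅ E`) gives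
`e [C] ∈ Σ ℤ[lines] + Rat₁(X)` where `e` is the push-forward coefficient of the first section of
`X ×ₖ Z → X`, i.e. the residue degree at the `K(Z)`-point `Spec K(Z) → Spec K → X` of the generic
fibre; that degree is COMPUTED here to be `[K(Z) : K] = [E : K] ≤ Bd`
(`ProjFamily.exists_le_smul_primeCycle_ratEquiv_lines_of_boundedChain`, via
`residueDegree_apply_eq_finrank`, `finrank_descResidueField_specMap_comp`,
`ProjFamily.algPt_specMap_comp_eq_pointOfVec`), so `Nu = Bd!` works for every curve.

Consequences (`Motives/LinesGenerateChowOneAlgebraicReduction`, Tian–Zong Lemma 3.4): the named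
fact `TianZong2014_chowOne_generatedByLines` follows from the two remaining inputs of §§3, 5, 6 of
the paper ALONE — (D) divisibility of the image of `Alg₁(X)` in `CH₁(X)` (Lemma 3.2, Bloch–Ogus
7.10, Jacobians of curves) and (G) generation of `CH₁(X)` by lines modulo algebraic equivalence
(Thm. 1.3 with Thm. 6.2, stable maps): `chowOneGeneratedByLines_of_algTrivial_of_sum_deg_le`,
`TianZong2014_chowOne_generatedByLines_of_divisible_of_algEquiv`.

## References

* [TianZong2014] Z. Tian, H. R. Zong, *One-cycles on rationally connected varieties*, Compositio
  Math. 150 (2014) 396–408, arXiv:1209.4342: Prop. 3.1 (p. 6), Lemma 3.4, proof of Thm. 6.1 (p. 9),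
  Prop. 7.1.
* J. Kollár, *Rational Curves on Algebraic Varieties*, Springer 1996, IV.3.13.3, V.4.8.1.
* W. Fulton, *Intersection Theory*, §1.4 (`deg(V/W) = [R(V) : R(W)]`). [Fulton1998]
-/

noncomputable section

open CategoryTheory CategoryTheory.Limits AlgebraicGeometry MonoidalCategory MvPolynomial
  TopologicalSpace Order

universe u

namespace Literature.AlgebraicGeometry.Motives

/-! ### Residue degrees at field-valued points -/

section ResidueDegree

open IsLocalRing

/-- Mathlib's `Scheme.descResidueField_stalkClosedPointTo_comp`, restated with the syntactic form
of the points used below. [folklore] -/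
theorem descResidueField_stalkClosedPointTo_comp' {F : Type u} [Field F] {Y X' : Scheme.{u}}
    (g : Spec (.of F) ⟶ Y) (π : Y ⟶ X') :
    X'.descResidueField (Scheme.stalkClosedPointTo (g ≫ π)) =
      π.residueFieldMap (g.base (closedPoint F)) ≫
        Y.descResidueField (Scheme.stalkClosedPointTo g) :=
  Scheme.descResidueField_stalkClosedPointTo_comp ..

/-- **The residue degree of `π` at the image of a field-valued point `g : Spec F → Y` with
`κ(g(pt)) = F`** is the degree of `F` over `κ(π g(pt))` along the embedding defined by the point
`g ≫ π`. [folklore] -/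
theorem residueDegree_apply_eq_finrank {F : Type u} [Field F] {Y X' : Scheme.{u}}
    (g : Spec (.of F) ⟶ Y) (π : Y ⟶ X')
    (hg : Function.Surjective (Y.descResidueField (Scheme.stalkClosedPointTo g))) :
    π.residueDegree (g.base (closedPoint F)) =
      (letI := (X'.descResidueField (Scheme.stalkClosedPointTo (g ≫ π))).hom.toAlgebra
       Module.finrank (X'.residueField ((g ≫ π).base (closedPoint F))) F) := by
  rw [descResidueField_stalkClosedPointTo_comp']
  set α := π.residueFieldMap (g.base (closedPoint F)) with hα
  set β := Y.descResidueField (Scheme.stalkClosedPointTo g) with hβ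
  letI algB : Algebra (X'.residueField (π.base (g.base (closedPoint F))))
      (Y.residueField (g.base (closedPoint F))) := α.hom.toAlgebra
  letI algF : Algebra (X'.residueField (π.base (g.base (closedPoint F)))) F := (α ≫ β).hom.toAlgebra
  let e : Y.residueField (g.base (closedPoint F)) ≃ₐ[X'.residueField (π.base (g.base (closedPoint F)))]
      F :=
    AlgEquiv.ofRingEquiv (f := RingEquiv.ofBijective β.hom ⟨β.hom.injective, hg⟩) (fun x => rfl)
  exact e.toLinearEquiv.finrank_eq

/-- If the point `g ≫ ρ` identifies `F` with the residue field, so does `g`. [folklore] -/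
theorem descResidueField_surjective_of_comp {F : Type u} [Field F] {Y Z' : Scheme.{u}}
    (g : Spec (.of F) ⟶ Y) (ρ : Y ⟶ Z')
    (h : Function.Surjective (Z'.descResidueField (Scheme.stalkClosedPointTo (g ≫ ρ)))) :
    Function.Surjective (Y.descResidueField (Scheme.stalkClosedPointTo g)) := by
  rw [descResidueField_stalkClosedPointTo_comp'] at h
  exact Function.Surjective.of_comp h

/-- **The degree of a field-valued point through a point with trivial residue extension.** For
`a : Spec K → X'` inducing isomorphisms on residue fields (e.g. the generic point of a closed
subvariety) and a field extension `χ : K → F'`, the degree of `F'` over `κ(a(pt))` along the point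
`Spec F' → Spec K → X'` is `[F' : K]`. [folklore] -/
theorem finrank_descResidueField_specMap_comp {K F' : Type u} [Field K] [Field F'] (χ : K →+* F')
    {X' : Scheme.{u}} (a : Spec (.of K) ⟶ X') (ha : ∀ x, Function.Surjective (a.residueFieldMap x)) :
    (letI := (X'.descResidueField
        (Scheme.stalkClosedPointTo (Spec.map (CommRingCat.ofHom χ) ≫ a))).hom.toAlgebra
     Module.finrank (X'.residueField ((Spec.map (CommRingCat.ofHom χ) ≫ a).base (closedPoint F')))
       F') = (letI := χ.toAlgebra; Module.finrank K F') := by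
  rw [descResidueField_stalkClosedPointTo_comp']
  set pt' := (Spec.map (CommRingCat.ofHom χ)).base (closedPoint F') with hpt'
  set α := a.residueFieldMap pt' with hα
  set δ := (Spec (.of K)).descResidueField (Scheme.stalkClosedPointTo (Spec.map (CommRingCat.ofHom χ)))
    with hδ
  -- the canonical `γ : K → κ(pt')`, bijective, with `δ ∘ γ = χ`
  let γ : K →+* (Spec (.of K)).residueField pt' :=
    ((Spec (.of K)).residue pt').hom.comp
      (((Spec (.of K)).presheaf.germ ⊤ pt' trivial).hom.comp (Scheme.ΓSpecIso (.of K)).inv.hom)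
  have hγδ : δ.hom.comp γ = χ := by
    have h1 := Scheme.germ_stalkClosedPointTo_Spec (CommRingCat.ofHom χ : CommRingCat.of K ⟶ .of F')
    have h2 := Scheme.residue_descResidueField (Scheme.stalkClosedPointTo (Spec.map (CommRingCat.ofHom χ)))
    -- `germ ≫ residue ≫ δ = ΓSpecIso.hom ≫ χ`
    have h3 : (Spec (.of K)).presheaf.germ ⊤ pt' trivial ≫ (Spec (.of K)).residue pt' ≫ δ =
        (Scheme.ΓSpecIso (.of K)).hom ≫ CommRingCat.ofHom χ := by
      rw [hδ, h2]; exact h1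
    have h4 : (Scheme.ΓSpecIso (.of K)).inv ≫ (Spec (.of K)).presheaf.germ ⊤ pt' trivial ≫
        (Spec (.of K)).residue pt' ≫ δ = CommRingCat.ofHom χ := by
      rw [h3, Iso.inv_hom_id_assoc]
    have h5 := congrArg (fun f => f.hom) h4
    exact RingHom.ext fun x => RingHom.congr_fun h5 x
  have hγsurj : Function.Surjective γ := by
    intro y
    obtain ⟨t, rfl⟩ := (Spec (.of K)).residue_surjective pt' y
    obtain ⟨U, hxU, s, rfl⟩ := (Spec (.of K)).presheaf.exists_germ_eq t
    have hpt : pt' = closedPoint K := Subsingleton.elim _ _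
    obtain rfl : U = ⊤ := (IsLocalRing.closedPoint_mem_iff U).mp (hpt ▸ hxU)
    refine ⟨(Scheme.ΓSpecIso (.of K)).hom s, ?_⟩
    change (Spec (.of K)).residue pt' ((Spec (.of K)).presheaf.germ ⊤ pt' trivial
      ((Scheme.ΓSpecIso (.of K)).inv ((Scheme.ΓSpecIso (.of K)).hom s))) = _
    rw [Iso.hom_inv_id_apply]
  -- both sides equal the degree of `F'` over `κ(pt')` along `δ`
  letI algA : Algebra (X'.residueField (a.base pt')) F' := (α ≫ δ).hom.toAlgebra
  letI algB : Algebra ((Spec (.of K)).residueField pt') F' := δ.hom.toAlgebra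
  have hAB : Module.finrank (X'.residueField (a.base pt')) F' =
      Module.finrank ((Spec (.of K)).residueField pt') F' :=
    Algebra.finrank_eq_of_equiv_equiv (RingEquiv.ofBijective α.hom ⟨α.hom.injective, ha pt'⟩)
      (RingEquiv.refl F') rfl
  have hKB : (letI := χ.toAlgebra; Module.finrank K F') =
      Module.finrank ((Spec (.of K)).residueField pt') F' := by
    letI := χ.toAlgebra
    refine Algebra.finrank_eq_of_equiv_equiv (RingEquiv.ofBijective γ ⟨γ.injective, hγsurj⟩)
      (RingEquiv.refl F') ?_
    ext x
    exact RingHom.congr_fun hγδ x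
  exact hAB.trans hKB.symm

end ResidueDegree

attribute [local instance] MvPolynomial.gradedAlgebra MvPolynomial.algebraMvPolynomial
  Literature.AlgebraicGeometry.Motives.ProjBaseChange.algebraBase
  UniversalHyperplaneSection.sectionsAlgebra ProjFamily.functionFieldAlgebra

namespace ProjFamily

open ProjBaseChangeRing ProjectiveSpaceCells ProjectiveSpace Literature.RingTheory.MvPolynomial
  IsLocalRing

variable {k : Type u} [Field k]

/-! ### The generic point identifies `k(B)` with the residue field -/

section GenericPoint

variable (B : SchemeOver k) [IsIntegral B.left]

/-- The generic point `Spec k(B) → B` identifies `k(B)` with the residue field `κ(η)`. [folklore] -/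
theorem descResidueField_qgen_surjective :
    Function.Surjective (B.left.descResidueField (K := B.left.functionField)
      (Scheme.stalkClosedPointTo (qgen B))) := by
  have h1 : Function.Surjective (Scheme.stalkClosedPointTo (qgen B)).hom := by
    have h := Scheme.stalkClosedPointTo_fromSpecStalk (X := B.left) (genericPoint B.left)
    change Function.Surjective
      (Scheme.stalkClosedPointTo (B.left.fromSpecStalk (genericPoint B.left))).hom
    rw [h]
    exact (B.left.presheaf.stalkCongr _).commRingCatIsoToRingEquiv.surjective
  rw [← Scheme.residue_descResidueField (K := B.left.functionField)
    (Scheme.stalkClosedPointTo (qgen B))] at h1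
  have h2 : Function.Surjective
      (⇑(B.left.descResidueField (K := B.left.functionField)
          (Scheme.stalkClosedPointTo (qgen B))).hom ∘
        ⇑(B.left.residue ((qgen B).base (closedPoint B.left.functionField))).hom) := h1
  exact Function.Surjective.of_comp h2

/-- `Spec k(B) → B → Y` is surjective on residue fields when `B → Y` is. [folklore] -/
theorem residueFieldMap_qgen_comp_surjective {Y : Scheme.{u}} (f : B.left ⟶ Y)
    (hf : ∀ y, Function.Surjective (f.residueFieldMap y)) (x : ↥(Spec B.left.functionField)) :
    Function.Surjective ((qgen B ≫ f).residueFieldMap x) := by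
  rw [Scheme.residueFieldMap_comp]
  exact (residueFieldMap_surjective_of_isPreimmersion (qgen B) x).comp (hf _)

/-- The `K(W)`-point `Spec K(W) → W ↪ Y` of the curve `W = closure {w}` is surjective on residue
fields. [folklore] -/
theorem residueFieldMap_qgen_curveOf_surjective {Y : SchemeOver k} (w : Y.left)
    (x : ↥(Spec (curveOf w).left.functionField)) :
    Function.Surjective
      ((qgen (curveOf w) ≫ (ClosedSubvariety.ofPoint Y.left w).ι).residueFieldMap x) := by
  have hf : ∀ y, Function.Surjective ((ClosedSubvariety.ofPoint Y.left w).ι.residueFieldMap y) :=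
    fun y => residueFieldMap_surjective_of_isPreimmersion (ClosedSubvariety.ofPoint Y.left w).ι y
  exact residueFieldMap_qgen_comp_surjective (curveOf w) _ hf x

end GenericPoint

/-! ### `K`-points of the generic fibre: composites and coordinates -/

section KPoints

variable (N : ℕ) (B : SchemeOver k) [IsIntegral B.left] (X : SchemeOver k)
  (i : X ⟶ projectiveSpace N k)
  (a : Spec B.left.functionField ⟶ X.left) (ha : a ≫ X.hom = qgen B ≫ B.hom)

/-- `sPt a ≫ (ℙᴺ_K → ℙᴺ_k) = a ≫ i`. [folklore] -/
theorem sPt_comp_projMap :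
    sPt N B X i a ha ≫ Proj.map (mapGraded k B.left.functionField (Fin (N + 1)))
      (irrelevant_le_map k B.left.functionField (Fin (N + 1))) = a ≫ i.left := by
  have e1 : sPt N B X i a ha ≫ Proj.map (mapGraded k B.left.functionField (Fin (N + 1)))
      (irrelevant_le_map k B.left.functionField (Fin (N + 1))) =
      (tPt B X a ha ≫ iK N B X i) ≫ (genericFibreι N B ≫
        (CartesianMonoidalCategory.fst (projectiveSpace N k) B).left) := by
    rw [genericFibreι_fst]
    rfl
  have e2 : (tPt B X a ha ≫ iK N B X i) ≫ (genericFibreι N B ≫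
        (CartesianMonoidalCategory.fst (projectiveSpace N k) B).left) =
      tPt B X a ha ≫ (ιX B X ≫ (i ▷ B).left) ≫
        (CartesianMonoidalCategory.fst (projectiveSpace N k) B).left := by
    rw [← iK_genericFibreι]
    simp only [Category.assoc]
  have e3 : tPt B X a ha ≫ (ιX B X ≫ (i ▷ B).left) ≫
        (CartesianMonoidalCategory.fst (projectiveSpace N k) B).left =
      tPt B X a ha ≫ ιX B X ≫ (CartesianMonoidalCategory.fst X B).left ≫ i.left := by
    rw [← whiskerRight_left_fst]
    simp only [Category.assoc]
  have e4 : tPt B X a ha ≫ ιX B X ≫ (CartesianMonoidalCategory.fst X B).left ≫ i.left =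
      a ≫ i.left := by
    conv_rhs => rw [← liftPt_fst B X a ha, ← tPt_ιX B X a ha]
    simp only [Category.assoc]
  exact e1.trans (e2.trans (e3.trans e4))

/-- `(tPt a ≫ ι) ≫ pr₂ = (Spec K → B)`, the generic point. [folklore] -/
theorem tPt_ιX_snd :
    (tPt B X a ha ≫ ιX B X) ≫ (CartesianMonoidalCategory.snd X B).left = qgen B := by
  rw [Category.assoc, (isPullback_ιX B X).w, ← Category.assoc, tPt_pX, Category.id_comp]

/-- `(tPt a ≫ ι) ≫ pr₁ = a`. [folklore] -/
theorem tPt_ιX_fst :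
    (tPt B X a ha ≫ ιX B X) ≫ (CartesianMonoidalCategory.fst X B).left = a := by
  rw [tPt_ιX, liftPt_fst]

/-- The point `tPt a ≫ ι : Spec K → X ×ₖ B` identifies `K` with the residue field of `X ×ₖ B` at
its image (it is a `K`-rational point of the generic fibre). [folklore] -/
theorem descResidueField_tPt_ιX_surjective :
    Function.Surjective ((X ⊗ B).left.descResidueField (K := B.left.functionField)
      (Scheme.stalkClosedPointTo (tPt B X a ha ≫ ιX B X))) := by
  refine descResidueField_surjective_of_comp _ (CartesianMonoidalCategory.snd X B).left ?_
  have key : ∀ f : Spec B.left.functionField ⟶ B.left, f = qgen B →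
      Function.Surjective (B.left.descResidueField (K := B.left.functionField)
        (Scheme.stalkClosedPointTo f)) := by
    rintro f rfl
    exact descResidueField_qgen_surjective B
  exact key _ (tPt_ιX_snd B X a ha)

/-- A `K`-point of `ℙᴺ_K` is a section of `ℙᴺ_K → Spec K`. [folklore] -/
theorem pointOfVec_left_projToSpec (v : Fin (N + 1) → B.left.functionField) (hv : v ≠ 0) :
    (pointOfVec B.left.functionField v hv).left ≫ projToSpec (Fin (N + 1)) B.left.functionField =
      𝟙 _ := by
  have hw := Over.w (pointOfVec B.left.functionField v hv)
  rw [projectiveSpace_hom_eq_projToSpec] at hw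
  rw [hw]
  change Spec.map (𝟙 _) = 𝟙 _
  exact Spec.map_id _

/-- **Coordinates of a composite point.** Let `a' : Spec K(B') → X` be a `K(B')`-point of `X`
with homogeneous coordinates `p` (as a point of `ℙᴺ`), and `φ : K(B') → K(B)` a `k`-embedding.
Then the `K(B)`-point `Spec K(B) → Spec K(B') → X` has homogeneous coordinates `φ ∘ p`.
[folklore] -/
theorem algPt_specMap_comp_eq_pointOfVec (B' : SchemeOver k) [IsIntegral B'.left]
    (a' : Spec B'.left.functionField ⟶ X.left) (ha' : a' ≫ X.hom = qgen B' ≫ B'.hom)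
    (φ : B'.left.functionField →ₐ[k] B.left.functionField)
    (haφ : (Spec.map (CommRingCat.ofHom φ.toRingHom) ≫ a') ≫ X.hom = qgen B ≫ B.hom)
    (p : Fin (N + 1) → B'.left.functionField) (hp : p ≠ 0)
    (hPp : pointOfVec B'.left.functionField p hp = algPt N B' X i a' ha') :
    algPt N B X i (Spec.map (CommRingCat.ofHom φ.toRingHom) ≫ a') haφ =
      pointOfVec B.left.functionField (φ ∘ p) (comp_ne_zero φ hp) := by
  -- both have the same composite with `ℙᴺ_K → ℙᴺ_k`
  have H1 := pointOfVec_left_comp_projMap (k := k) (L := B.left.functionField) (φ ∘ p)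
    (comp_ne_zero φ hp)
  have H2 := pointOfVec_left_comp_algHom φ p hp
  have H3 := (pointOfVec_left_comp_projMap (k := k) (L := B'.left.functionField) p hp).symm
  have H4 : (pointOfVec B'.left.functionField p hp).left = sPt N B' X i a' ha' := by
    rw [hPp]; rfl
  have H5 := sPt_comp_projMap N B' X i a' ha'
  have E : (pointOfVec k p hp).left = a' ≫ i.left :=
    H3.trans ((congrArg (fun f => f ≫ Proj.map (mapGraded k B'.left.functionField (Fin (N + 1)))
      (irrelevant_le_map k B'.left.functionField (Fin (N + 1)))) H4).trans H5)
  have H := H1.trans (H2.trans ((congrArg (fun f => Spec.map (CommRingCat.ofHom φ.toRingHom) ≫ f)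
    E).trans (Category.assoc _ _ _).symm))
  have h₀ := (sPt_comp_projMap N B X i _ haφ).trans H.symm
  have h₁ := (sPt_projToSpec N B X i _ haφ).trans
    (pointOfVec_left_projToSpec N B (φ ∘ p) (comp_ne_zero φ hp)).symm
  apply Over.OverMorphism.ext
  exact (isPullback_projMap' k B.left.functionField (n := N)).hom_ext h₀ h₁

/-- **The degree of the first section.** For a `K(B)`-point of `X` of the form
`Spec K(B) → Spec K(B') → X` through a point `a'` with trivial residue extensions (e.g. the generic
point of a closed subvariety with function field `K(B')`), the residue degree of
`pr₁ : X ×ₖ B → X` at the corresponding point of the generic fibre is `[K(B) : K(B')]`.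
[folklore] -/
theorem residueDegree_fst_uXPt_specMap_comp (B' : SchemeOver k) [IsIntegral B'.left]
    (a' : Spec B'.left.functionField ⟶ X.left)
    (φ : B'.left.functionField →ₐ[k] B.left.functionField)
    (haφ : (Spec.map (CommRingCat.ofHom φ.toRingHom) ≫ a') ≫ X.hom = qgen B ≫ B.hom)
    (hsurj : ∀ x, Function.Surjective (a'.residueFieldMap x)) :
    (CartesianMonoidalCategory.fst X B).left.residueDegree
        ((ιX B X).base (uXPt B X (Spec.map (CommRingCat.ofHom φ.toRingHom) ≫ a') haφ)) =
      (letI := φ.toRingHom.toAlgebra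
       Module.finrank B'.left.functionField B.left.functionField) := by
  have h1 := residueDegree_apply_eq_finrank (F := B.left.functionField)
    (tPt B X _ haφ ≫ ιX B X) (CartesianMonoidalCategory.fst X B).left
    (descResidueField_tPt_ιX_surjective B X _ haφ)
  have h2 : ∀ f : Spec B.left.functionField ⟶ X.left,
      f = Spec.map (CommRingCat.ofHom φ.toRingHom) ≫ a' →
      (letI := (X.left.descResidueField (K := B.left.functionField)
        (Scheme.stalkClosedPointTo f)).hom.toAlgebra
       Module.finrank (X.left.residueField (f.base (closedPoint B.left.functionField)))
         B.left.functionField) =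
      (letI := φ.toRingHom.toAlgebra
       Module.finrank B'.left.functionField B.left.functionField) := by
    rintro f rfl
    exact finrank_descResidueField_specMap_comp (K := B'.left.functionField)
      (F' := B.left.functionField) φ.toRingHom a' hsurj
  exact h1.trans (h2 _ (tPt_ιX_fst B X _ haφ))

end KPoints

/-! ### Moving a chain over an abstract finite extension into the algebraic closure -/

section Transport

variable {K : Type u} [Field K] [Algebra k K] {N : ℕ}

/-- A chain of lines over an abstract extension `E₀/K` of degree `≤ Bd` gives one over an
intermediate field of the algebraic closure of `K`, of degree `≤ Bd` (embed `E₀` by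
`IsAlgClosed.lift` and take its field range). [folklore] -/
theorem exists_intermediateField_boundedChain {c : ℕ} (F : Fin c → MvPolynomial (Fin (N + 1)) k)
    (p q : Fin (N + 1) → K) (Bd : ℕ)
    (h : ∃ (E : Type u) (_ : Field E) (_ : Algebra K E),
      Module.finrank K E ≤ Bd ∧ 0 < Module.finrank K E ∧
      ∃ (r : ℕ) (v : ℕ → Fin (N + 1) → E), v 0 = algebraMap K E ∘ p ∧
        v (r + 1) = algebraMap K E ∘ q ∧ (∀ j ≤ r + 1, v j ≠ 0) ∧
        ∀ j ≤ r, ∀ a (s t : E), eval (s • v j + t • v (j + 1))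
          (MvPolynomial.map ((algebraMap K E).comp (algebraMap k K)) (F a)) = 0) :
    ∃ E : IntermediateField K (AlgebraicClosure K), FiniteDimensional K E ∧
      Module.finrank K E ≤ Bd ∧
      ∃ (r : ℕ) (w : ℕ → Fin (N + 1) → E), w 0 = (algebraMap K E) ∘ p ∧
        w (r + 1) = (algebraMap K E) ∘ q ∧ (∀ j ≤ r + 1, w j ≠ 0) ∧
        ∀ j ≤ r, ∀ a (s t : E), eval (s • w j + t • w (j + 1))
          (MvPolynomial.map (algebraMap K E) (MvPolynomial.map (algebraMap k K) (F a))) = 0 := by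
  obtain ⟨E₀, _instE₀, _algE₀, hE₀le, hE₀pos, r, wE₀, hwE₀0, hwE₀r, hwE₀ne, hwE₀link⟩ := h
  haveI : FiniteDimensional K E₀ := Module.finite_of_finrank_pos hE₀pos
  haveI : Algebra.IsAlgebraic K E₀ := Algebra.IsAlgebraic.of_finite K E₀
  let emb : E₀ →ₐ[K] AlgebraicClosure K := IsAlgClosed.lift
  refine ⟨emb.fieldRange, Module.Finite.equiv emb.equivFieldRange.toLinearEquiv, ?_, r,
    fun j l => ⟨emb (wE₀ j l), AlgHom.mem_fieldRange.mpr ⟨wE₀ j l, rfl⟩⟩, ?_, ?_, ?_, ?_⟩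
  · rw [← emb.equivFieldRange.toLinearEquiv.finrank_eq]; exact hE₀le
  · funext l
    apply Subtype.ext
    change emb (wE₀ 0 l) = algebraMap K (AlgebraicClosure K) (p l)
    rw [hwE₀0]
    exact emb.commutes (p l)
  · funext l
    apply Subtype.ext
    change emb (wE₀ (r + 1) l) = algebraMap K (AlgebraicClosure K) (q l)
    rw [hwE₀r]
    exact emb.commutes (q l)
  · intro j hj h0
    refine hwE₀ne j hj ?_
    funext l
    have hl : emb (wE₀ j l) = 0 :=
      congrArg (fun x : ↥emb.fieldRange => (x : AlgebraicClosure K)) (congrFun h0 l)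
    exact emb.toRingHom.injective (hl.trans (map_zero _).symm)
  · intro j hj b s t
    obtain ⟨s₀, hs₀⟩ := AlgHom.mem_fieldRange.mp s.2
    obtain ⟨t₀, ht₀⟩ := AlgHom.mem_fieldRange.mp t.2
    apply (algebraMap (↥emb.fieldRange) (AlgebraicClosure K)).injective
    have hwval : ∀ j', (algebraMap (↥emb.fieldRange) (AlgebraicClosure K)) ∘
        (fun l => (⟨emb (wE₀ j' l), AlgHom.mem_fieldRange.mpr ⟨wE₀ j' l, rfl⟩⟩ : ↥emb.fieldRange)) =
        emb ∘ wE₀ j' := fun j' => funext fun l => rfl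
    rw [map_zero, ← eval_comp_map, comp_smul_add_smul, hwval, hwval, MvPolynomial.map_map,
      MvPolynomial.map_map, ← IsScalarTower.algebraMap_eq K (↥emb.fieldRange) (AlgebraicClosure K),
      ← emb.comp_algebraMap, RingHom.comp_assoc, ← MvPolynomial.map_map]
    have hs' : (algebraMap (↥emb.fieldRange) (AlgebraicClosure K)) s = emb s₀ := hs₀.symm
    have ht' : (algebraMap (↥emb.fieldRange) (AlgebraicClosure K)) t = emb t₀ := ht₀.symm
    rw [hs', ht', show emb s₀ • (⇑emb ∘ wE₀ j) + emb t₀ • (⇑emb ∘ wE₀ (j + 1)) =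
      ⇑(emb : E₀ →+* AlgebraicClosure K) ∘ (s₀ • wE₀ j + t₀ • wE₀ (j + 1)) from
      (comp_smul_add_smul (emb : E₀ →+* AlgebraicClosure K) s₀ t₀ _ _).symm, eval_comp_map]
    change emb (eval (s₀ • wE₀ j + t₀ • wE₀ (j + 1))
      (MvPolynomial.map ((algebraMap K E₀).comp (algebraMap k K)) (F b))) = 0
    rw [hwE₀link j hj b s₀ t₀, map_zero]

end Transport

/-! ### The relation `e · [C] ~ Σ nᵢ [ℓᵢ]` with `e ≤ Bd` -/

section MainBounded

variable [IsAlgClosed k] {N : ℕ} (X : SchemeOver k) (i : X ⟶ projectiveSpace N k)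
  [IsClosedImmersion i.left]

set_option maxHeartbeats 800000 in
/-- **A multiple `e [C]`, `0 < e ≤ Bd`, of every curve class is an integral combination of lines,
given chains of lines over extensions of degree `≤ Bd`** (Tian–Zong's product trick, Prop. 7.1,
with the degree of the base change CONTROLLED: the integer `N` of Prop. 3.1 / Kollár IV.3.13.3).
Let `X = V₊(F) ⊆ ℙᴺ_k` be closed (`k` algebraically closed) and assume that for every field
`K ⊇ k` any two non-zero zeros `p, q ∈ Kᴺ⁺¹` of the `F_a` are joined by a chain of lines of
`V(F)` with coordinates in an extension `E/K` of degree `0 < [E : K] ≤ Bd` (`hchainB`;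
`Literature.RingTheory.MvPolynomial.exists_chain_finrank_bound` for `Σ d_a + 1 ≤ N`). Then for
every integral curve `C = closure {z₀} ⊆ X` there is `e` with `0 < e ≤ Bd` and
`e [C] ∈ Σ ℤ [lines] + Rat₁(X)`. The proof is that of
`exists_pos_smul_primeCycle_ratEquiv_lines_of_chain` over the normalisation `Z` of `C` in `E`,
with the push-forward coefficient of the first section COMPUTED: it is the residue degree of
`pr₁ : X ×ₖ Z → X` at the `K(Z)`-point `Spec K(Z) → Spec K(C) → X` of the generic fibre
(`algPt_specMap_comp_eq_pointOfVec`, `residueDegree_apply_eq_finrank`,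
`finrank_descResidueField_specMap_comp`), i.e. `[K(Z) : K(C)] = [E : K] ≤ Bd`.
[cite: TianZong2014, Prop. 3.1, Prop. 7.1 and proof of Thm. 6.1] -/
theorem exists_le_smul_primeCycle_ratEquiv_lines_of_boundedChain (hN : 1 ≤ N)
    {c : ℕ} (F : Fin c → MvPolynomial (Fin (N + 1)) k) (d : Fin c → ℕ)
    (hFhom : ∀ b, (F b).IsHomogeneous (d b)) (hd : ∀ b, 0 < d b)
    (hrange : Set.range i.left.base =
      ProjectiveSpectrum.zeroLocus (homogeneousSubmodule (Fin (N + 1)) k) (Set.range F))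
    (Bd : ℕ)
    (hchainB : ∀ (K : Type u) [Field K] [Algebra k K] (p q : Fin (N + 1) → K), p ≠ 0 → q ≠ 0 →
      (∀ a, eval p (MvPolynomial.map (algebraMap k K) (F a)) = 0) →
      (∀ a, eval q (MvPolynomial.map (algebraMap k K) (F a)) = 0) →
      ∃ (E : Type u) (_ : Field E) (_ : Algebra K E),
        Module.finrank K E ≤ Bd ∧ 0 < Module.finrank K E ∧
        ∃ (r : ℕ) (v : ℕ → Fin (N + 1) → E), v 0 = algebraMap K E ∘ p ∧
          v (r + 1) = algebraMap K E ∘ q ∧ (∀ j ≤ r + 1, v j ≠ 0) ∧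
          ∀ j ≤ r, ∀ a (s t : E), eval (s • v j + t • v (j + 1))
            (MvPolynomial.map ((algebraMap K E).comp (algebraMap k K)) (F a)) = 0)
    (z₀ : ↥X.left) (hz : height z₀ = 1) :
    ∃ e : ℕ, 0 < e ∧ e ≤ Bd ∧ ∃ (s : Finset ↥X.left) (w : ↥X.left → ℤ),
      (∀ y ∈ s, IsLinePoint N i y) ∧
      IsRationallyEquivalent ((e : ℤ) • primeCycle z₀) (∑ y ∈ s, w y • primeCycle y) 1 := by
  classical
  -- instances on `X`
  haveI : IsProper (projectiveSpace N k).hom := isProper_projectiveSpace N k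
  haveI : IsProper X.hom := by rw [← Over.w i]; infer_instance
  -- the curve `W = closure {z₀}` over `k` and its generic point as a `K`-point of `X`
  let W : SchemeOver k := curveOf z₀
  let aW : Spec W.left.functionField ⟶ X.left := qgen W ≫ (ClosedSubvariety.ofPoint X.left z₀).ι
  have haW : aW ≫ X.hom = qgen W ≫ W.hom := by
    simp only [aW, Category.assoc]
    rfl
  have hqgenW : (qgen W).base (IsLocalRing.closedPoint W.left.functionField) = genericPoint W.left := by
    have h : (qgen W).base (IsLocalRing.closedPoint W.left.functionField) ∈ Set.range (qgen W).base :=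
      ⟨_, rfl⟩
    rwa [range_qgen, Set.mem_singleton_iff] at h
  have haWpt : aW.base (IsLocalRing.closedPoint W.left.functionField) = z₀ := by
    change (ClosedSubvariety.ofPoint X.left z₀).ι.base ((qgen W).base _) = z₀
    rw [hqgenW]
    exact ClosedSubvariety.genericPoint_ofPoint z₀
  -- a closed point `x₀` of `X` below `z₀` and the constant `K`-point at `x₀`
  obtain ⟨x₀, hx₀lt⟩ : ∃ x₀, x₀ < z₀ := by
    have h : ¬ IsMin z₀ := fun hmin => by
      have := Order.height_eq_zero.mpr hmin
      rw [hz] at this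
      exact one_ne_zero this
    simpa [not_isMin_iff] using h
  have hx₀0 : height x₀ = 0 := by
    have h := height_strictMono hx₀lt (by
      refine lt_of_le_of_lt (height_mono hx₀lt.le) ?_
      rw [hz]; exact ENat.coe_lt_top 1)
    rw [hz] at h
    exact Order.lt_one_iff.mp h
  have hx₀ : IsClosed ({x₀} : Set ↥X.left) := isClosed_singleton_of_height_eq_zero' hx₀0
  let a₀W : Spec W.left.functionField ⟶ X.left :=
    qgen W ≫ W.hom ≫ pointOfClosedPoint X.hom x₀ hx₀
  have ha₀W : a₀W ≫ X.hom = qgen W ≫ W.hom := by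
    simp only [a₀W, Category.assoc, pointOfClosedPoint_comp, Category.comp_id]
  have ha₀Wpt : a₀W.base (IsLocalRing.closedPoint W.left.functionField) = x₀ :=
    pointOfClosedPoint_apply X.hom x₀ hx₀ _
  -- homogeneous coordinates `p, q ∈ Kᴺ⁺¹`
  obtain ⟨p, hp0, hPp⟩ := exists_eq_pointOfVec (algPt N W X i aW haW)
  obtain ⟨q, hq0, hPq⟩ := exists_eq_pointOfVec (algPt N W X i a₀W ha₀W)
  have hptp : (pointOfVec W.left.functionField p hp0).pt = uPt N W X i aW haW := by
    rw [← hPp]; rfl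
  have hptq : (pointOfVec W.left.functionField q hq0).pt = uPt N W X i a₀W ha₀W := by
    rw [← hPq]; rfl
  have hFmem : ∀ (a' : Spec W.left.functionField ⟶ X.left) (ha' : a' ≫ X.hom = qgen W ≫ W.hom) b,
      MvPolynomial.map (algebraMap k W.left.functionField) (F b) ∈
        ProjectiveSpectrum.asHomogeneousIdeal
          (𝒜 := homogeneousSubmodule (Fin (N + 1)) W.left.functionField) (uPt N W X i a' ha') := by
    intro a' ha' b
    refine map_mem_asHomogeneousIdeal_uPt N W X i a' ha' ?_
    have hmem : i.left.base (a'.base (IsLocalRing.closedPoint W.left.functionField)) ∈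
        Set.range i.left.base := ⟨_, rfl⟩
    rw [hrange] at hmem
    exact hmem ⟨b, rfl⟩
  have hFp : ∀ b, eval p (MvPolynomial.map (algebraMap k W.left.functionField) (F b)) = 0 :=
    fun b => eval_eq_zero_of_mem_asHomogeneousIdeal_pt_pointOfVec hp0 (hd b) ((hFhom b).map _)
      (hptp ▸ hFmem aW haW b)
  have hFq : ∀ b, eval q (MvPolynomial.map (algebraMap k W.left.functionField) (F b)) = 0 :=
    fun b => eval_eq_zero_of_mem_asHomogeneousIdeal_pt_pointOfVec hq0 (hd b) ((hFhom b).map _)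
      (hptq ▸ hFmem a₀W ha₀W b)
  -- the images of `[p]`, `[q]` in `ℙᴺ_k` are `i z₀`, `i x₀`
  have hip : (pointOfVec k p hp0).pt = i.left.base z₀ := by
    rw [← projMap_pt_pointOfVec, hptp, ← i_apply_eq_projMap_uPt N W X i aW haW, haWpt]
  have hiq : (pointOfVec k q hq0).pt = i.left.base x₀ := by
    rw [← projMap_pt_pointOfVec, hptq, ← i_apply_eq_projMap_uPt N W X i a₀W ha₀W, ha₀Wpt]
  -- the chain over a finite extension `E/K` of degree `≤ Bd` inside the algebraic closure
  obtain ⟨E, hEfin, hEle, r, wE, hwE0, hwEr, hwEne, hwElink⟩ :=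
    exists_intermediateField_boundedChain F p q Bd (hchainB W.left.functionField p q hp0 hq0 hFp hFq)
  haveI : FiniteDimensional W.left.functionField E := hEfin
  -- the normalisation `Z` of `W` in `E`
  let Z : SchemeOver k := paramCurve z₀ (↥E)
  have hZ1 : height (genericPoint Z.left) = 1 := by
    rw [height_genericPoint_paramCurve]; exact hz
  have hpid : ∀ b : Z.left, IsClosed ({b} : Set Z.left) →
      IsPrincipalIdealRing (Z.left.presheaf.stalk b) := by
    intro b hb
    have hne : b ≠ genericPoint Z.left := fun h => by
      have h0 := height_eq_zero_of_isClosed_singleton hb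
      rw [h, hZ1] at h0
      exact one_ne_zero h0
    haveI := isDiscreteValuationRing_stalk_paramCurve z₀ (↥E) hz hne
    infer_instance
  -- `K(Z) ≅ E` and the `k`-algebra map `ψ : K → K(Z)`
  let g : specOver k (↥E) ⟶ Z := paramGen z₀ (↥E)
  have hg : g.left.base (IsLocalRing.closedPoint (↥E)) = genericPoint Z.left := by
    have h : g.left.base (IsLocalRing.closedPoint (↥E)) ∈ Set.range g.left.base := ⟨_, rfl⟩
    have hr : Set.range g.left.base = {genericPoint Z.left} := range_paramGen z₀ (↥E)
    rw [hr] at h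
    exact h
  obtain ⟨θ, -, hθ2⟩ := exists_ringEquiv_of_presentation Z g hg
  have hθ2' : ∀ x, θ (algebraMap k Z.left.functionField x) = algebraMap k (↥E) x :=
    fun x => RingHom.congr_fun hθ2 x
  let ψ : W.left.functionField →ₐ[k] Z.left.functionField :=
    { toRingHom := θ.symm.toRingHom.comp (algebraMap W.left.functionField (↥E))
      commutes' := fun x => by
        change θ.symm (algebraMap W.left.functionField (↥E) (algebraMap k W.left.functionField x)) =
          algebraMap k Z.left.functionField x
        rw [← IsScalarTower.algebraMap_apply k W.left.functionField (↥E) x, ← hθ2' x,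
          RingEquiv.symm_apply_apply] }
  -- the chain over `K(Z)`
  let pZ : Fin (N + 1) → Z.left.functionField := ψ ∘ p
  let qZ : Fin (N + 1) → Z.left.functionField := ψ ∘ q
  let wZ : ℕ → Fin (N + 1) → Z.left.functionField := fun j l => θ.symm (wE j l)
  have hpZ0 : pZ ≠ 0 := comp_ne_zero ψ hp0
  have hqZ0 : qZ ≠ 0 := comp_ne_zero ψ hq0
  have hwZ0 : wZ 0 = pZ := by
    funext l
    change θ.symm (wE 0 l) = θ.symm (algebraMap W.left.functionField (↥E) (p l))
    rw [hwE0]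
    rfl
  have hwZr : wZ (r + 1) = qZ := by
    funext l
    change θ.symm (wE (r + 1) l) = θ.symm (algebraMap W.left.functionField (↥E) (q l))
    rw [hwEr]
    rfl
  have hwZne : ∀ j ≤ r + 1, wZ j ≠ 0 := fun j hj h0 => hwEne j hj (by
    funext l
    have hl : θ.symm (wE j l) = 0 := congrFun h0 l
    exact θ.symm.injective (hl.trans (map_zero θ.symm).symm))
  have hmapθ : ∀ b, MvPolynomial.map θ.toRingHom
      (MvPolynomial.map (algebraMap k Z.left.functionField) (F b)) =
      MvPolynomial.map (algebraMap W.left.functionField (↥E))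
        (MvPolynomial.map (algebraMap k W.left.functionField) (F b)) := by
    intro b
    rw [MvPolynomial.map_map, MvPolynomial.map_map, hθ2,
      IsScalarTower.algebraMap_eq k W.left.functionField (↥E)]
  have hθw : ∀ j, ⇑θ.toRingHom ∘ wZ j = wE j := fun j => funext fun l => θ.apply_symm_apply _
  have hrel : ∀ j ≤ r, ∀ b (s t : Z.left.functionField),
      eval (s • wZ j + t • wZ (j + 1)) (MvPolynomial.map (algebraMap k Z.left.functionField) (F b)) =
        0 := by
    intro j hj b s t
    apply θ.toRingHom.injective
    rw [map_zero, ← eval_comp_map θ.toRingHom, comp_smul_add_smul, hmapθ, hθw, hθw]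
    exact hwElink j hj b _ _
  have hFw : ∀ j ≤ r + 1, ∀ b,
      eval (wZ j) (MvPolynomial.map (algebraMap k Z.left.functionField) (F b)) = 0 := by
    intro j hj b
    rcases Nat.lt_or_ge j (r + 1) with hlt | hge
    · have h := hrel j (by omega) b 1 0
      rwa [one_smul, zero_smul, add_zero] at h
    · have hj' : j = r + 1 := le_antisymm hj hge
      obtain ⟨r', hr'⟩ : ∃ r', j = r' + 1 := ⟨r, hj'⟩
      have h := hrel r' (by omega) b 0 1
      rwa [zero_smul, one_smul, zero_add, ← hr'] at h
  -- instances on `X ×ₖ Z`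
  haveI : LocallyOfFiniteType (X ⊗ Z).hom :=
    inferInstanceAs (LocallyOfFiniteType (pullback.fst X.hom Z.hom ≫ X.hom))
  haveI : IsProper (CartesianMonoidalCategory.fst X Z).left :=
    inferInstanceAs (IsProper (pullback.fst X.hom Z.hom))
  haveI : QuasiCompact (X ⊗ Z).hom :=
    inferInstanceAs (QuasiCompact (pullback.fst X.hom Z.hom ≫ X.hom))
  haveI : CompactSpace ↥(X ⊗ Z).left := compactSpace_of_quasiCompact_hom (X ⊗ Z)
  haveI : LocallyOfFiniteType ((CartesianMonoidalCategory.fst X Z).left ≫ X.hom) :=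
    inferInstanceAs (LocallyOfFiniteType (X ⊗ Z).hom)
  haveI : LocallyOfFiniteType (CartesianMonoidalCategory.fst X Z).left :=
    inferInstanceAs (LocallyOfFiniteType (pullback.fst X.hom Z.hom))
  haveI := infinite_functionField (k := k) Z
  have hP := isPullback_ιX Z X
  have hi := range_qgen Z
  have hinjK : Function.Injective (iK N Z X i).base := (iK N Z X i).isClosedEmbedding.injective
  -- points of `X_{K(Z)}` with rational coordinates: dimension of their closure in `X × Z`
  have hh1 : ∀ (u : ↥(XK Z X)) (v : Fin (N + 1) → Z.left.functionField) (hv : v ≠ 0),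
      (iK N Z X i).base u = (pointOfVec Z.left.functionField v hv).pt →
        height ((ιX Z X).base u) = 1 := by
    intro u v hv hu
    let V : ClosedSubvariety (XK Z X) := ClosedSubvariety.ofPoint _ u
    have hdim := dim_image_eq hP hi hZ1 V
    have hV : V.dim = 0 := by
      change height V.genericPoint = 0
      rw [ClosedSubvariety.genericPoint_ofPoint, ← height_base_eq_of_isClosedImmersion' (iK N Z X i),
        hu]
      exact height_pt _
    have hI : (V.image (ιX Z X)).dim = height ((ιX Z X).base u) := by
      change height (V.image (ιX Z X)).genericPoint = _
      rw [ClosedSubvariety.genericPoint_image, ClosedSubvariety.genericPoint_ofPoint]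
    rw [← hI, hdim, hV]
    rfl
  have hfst_p : ∀ u : ↥(XK Z X),
      (iK N Z X i).base u = (pointOfVec Z.left.functionField pZ hpZ0).pt →
      (CartesianMonoidalCategory.fst X Z).left.base ((ιX Z X).base u) = z₀ := by
    intro u hu
    apply i.left.isClosedEmbedding.injective
    rw [i_fst_ιX_eq_pt_pointOfVec Z X i ψ p hp0 u hu, hip]
  have hfst_q : ∀ u : ↥(XK Z X),
      (iK N Z X i).base u = (pointOfVec Z.left.functionField qZ hqZ0).pt →
      (CartesianMonoidalCategory.fst X Z).left.base ((ιX Z X).base u) = x₀ := by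
    intro u hu
    apply i.left.isClosedEmbedding.injective
    rw [i_fst_ιX_eq_pt_pointOfVec Z X i ψ q hq0 u hu, hiq]
  -- push-forward along `pr₁ : X × Z → X`
  let M : AlgebraicCycle (X ⊗ Z).left ℤ →+ AlgebraicCycle X.left ℤ :=
    AddMonoidHom.mk' (AlgebraicCycle.map (CartesianMonoidalCategory.fst X Z).left height height)
      (algebraicCycleMap_add _ height height)
  have hMrat : ∀ c' ∈ ratTrivial (X ⊗ Z).left 1, M c' ∈ ratTrivial X.left 1 :=
    fun c' hc' => map_mem_ratTrivial_holds (d := 1) (CartesianMonoidalCategory.fst X Z) hc'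
  have hMp : ∀ u : ↥(XK Z X),
      (iK N Z X i).base u = (pointOfVec Z.left.functionField pZ hpZ0).pt →
      (CartesianMonoidalCategory.fst X Z).left.residueDegree ((ιX Z X).base u) ≠ 0 ∧
        M (primeCycle ((ιX Z X).base u)) =
          ((CartesianMonoidalCategory.fst X Z).left.residueDegree ((ιX Z X).base u) : ℤ) •
            primeCycle z₀ := by
    intro u hu
    have hcoeff : AlgebraicCycle.mapCoeff (CartesianMonoidalCategory.fst X Z).left height height
        ((ιX Z X).base u) =
        (CartesianMonoidalCategory.fst X Z).left.residueDegree ((ιX Z X).base u) := by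
      rw [AlgebraicCycle.mapCoeff, if_pos (by rw [hh1 u pZ hpZ0 hu, hfst_p u hu, hz])]
    refine ⟨?_, ?_⟩
    · rw [← hcoeff]
      exact mapCoeff_ne_zero_of_height_eq (CartesianMonoidalCategory.fst X Z).left X.hom _
        (hh1 u pZ hpZ0 hu) (by rw [hfst_p u hu, hz, Nat.cast_one])
    · change AlgebraicCycle.map (CartesianMonoidalCategory.fst X Z).left height height _ = _
      rw [algebraicCycleMap_primeCycle_eq_nsmul, natCast_zsmul, hfst_p u hu, hcoeff]
  have hMq : ∀ u : ↥(XK Z X),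
      (iK N Z X i).base u = (pointOfVec Z.left.functionField qZ hqZ0).pt →
      M (primeCycle ((ιX Z X).base u)) = 0 := by
    intro u hu
    change AlgebraicCycle.map (CartesianMonoidalCategory.fst X Z).left height height _ = _
    rw [algebraicCycleMap_primeCycle_eq_nsmul]
    have hne : height ((ιX Z X).base u) ≠
        height ((CartesianMonoidalCategory.fst X Z).left.base ((ιX Z X).base u)) := by
      rw [hh1 u qZ hqZ0 hu, hfst_q u hu, hx₀0]; exact one_ne_zero
    rw [AlgebraicCycle.mapCoeff, if_neg hne, zero_smul]
  have key_line : ∀ V : AlgebraicCycle (X ⊗ Z).left ℤ,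
      (∀ z, V z ≠ 0 → IsLinePoint N i ((CartesianMonoidalCategory.fst X Z).left.base z)) →
      ∃ s : Finset ↥X.left, (∀ y ∈ s, IsLinePoint N i y) ∧ Function.support (M V) ⊆ s := by
    intro V hV
    refine ⟨(finite_support_of_compactSpace V).toFinset.image
      (CartesianMonoidalCategory.fst X Z).left.base, ?_, ?_⟩
    · intro y hy
      rw [Finset.mem_image] at hy
      obtain ⟨z, hz', rfl⟩ := hy
      exact hV z (Function.mem_support.mp ((Set.Finite.mem_toFinset _).mp hz'))
    · exact support_map_subset _ V _ (by rw [Set.Finite.coe_toFinset])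
  -- reduction to a relation `M c' = e [z₀] + M V` in `X × Z`
  suffices h : ∃ e : ℕ, e ≠ 0 ∧ e ≤ Bd ∧ ∃ c' ∈ ratTrivial (X ⊗ Z).left 1,
      ∃ V : AlgebraicCycle (X ⊗ Z).left ℤ,
        M c' = (e : ℤ) • primeCycle z₀ + M V ∧
          ∀ z, V z ≠ 0 → IsLinePoint N i ((CartesianMonoidalCategory.fst X Z).left.base z) by
    obtain ⟨e, he, hele, c', hc', V, hMc', hV⟩ := h
    obtain ⟨s, hs, hsupp⟩ := key_line V hV
    refine ⟨e, Nat.pos_of_ne_zero he, hele, s, fun y => -((M V) y), hs, ?_⟩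
    change (e : ℤ) • primeCycle z₀ - ∑ y ∈ s, (-((M V) y)) • primeCycle y ∈ ratTrivial X.left 1
    have hsum : ∑ y ∈ s, (-((M V) y)) • primeCycle y = -(M V) := by
      rw [eq_sum_smul_primeCycle_of_support_subset (-(M V)) (s := s)
        (by rw [Function.locallyFinsuppWithin.coe_neg, Function.support_neg]; exact hsupp)]
      rfl
    rw [hsum, sub_neg_eq_add, ← hMc']
    exact hMrat c' hc'
  -- the points `u_j ∈ X_{K(Z)}` of the chain (indices beyond `r + 1` are clamped)
  have hex : ∀ j, ∃ u : ↥(XK Z X), (iK N Z X i).base u =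
      (pointOfVec Z.left.functionField (wZ (min j (r + 1)))
        (hwZne _ (Nat.min_le_right j (r + 1)))).pt := fun j =>
    pt_pointOfVec_mem_range_iK X i Z F d hFhom hd hrange _ _
      (hFw _ (Nat.min_le_right j (r + 1)))
  choose u hu using hex
  let T : ℕ → AlgebraicCycle (X ⊗ Z).left ℤ := fun j => primeCycle ((ιX Z X).base (u j))
  -- one relation per link
  have hlinkrel : ∀ j : Fin (r + 1), ∃ c' ∈ ratTrivial (X ⊗ Z).left 1,
      ∃ V : AlgebraicCycle (X ⊗ Z).left ℤ, c' = T j - T ((j : ℕ) + 1) + V ∧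
        ∀ z, V z ≠ 0 → IsLinePoint N i ((CartesianMonoidalCategory.fst X Z).left.base z) := by
    intro j
    have hj : (j : ℕ) ≤ r := Nat.lt_succ_iff.mp j.2
    have hminj : min (j : ℕ) (r + 1) = j := Nat.min_eq_left (by omega)
    have hminj1 : min ((j : ℕ) + 1) (r + 1) = (j : ℕ) + 1 := Nat.min_eq_left (by omega)
    have huj : (iK N Z X i).base (u j) =
        (pointOfVec Z.left.functionField (wZ j) (hwZne _ (by omega))).pt := by
      rw [hu j]; congr 1; simp only [hminj]
    have huj1 : (iK N Z X i).base (u ((j : ℕ) + 1)) =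
        (pointOfVec Z.left.functionField (wZ ((j : ℕ) + 1)) (hwZne _ (by omega))).pt := by
      rw [hu ((j : ℕ) + 1)]; congr 1; simp only [hminj1]
    by_cases hind : LinearIndependent Z.left.functionField ![wZ j, wZ ((j : ℕ) + 1)]
    · obtain ⟨c', hc', uX, huX, V, hcV, hV⟩ := exists_relation_of_line Z X i hN hZ1 hpid F hrange
        ![wZ j, wZ ((j : ℕ) + 1)] hind (fun b s t => hrel j hj b s t)
      have h0 : uX 0 = u j := hinjK (by rw [huX 0, huj]; rfl)
      have h1 : uX 1 = u ((j : ℕ) + 1) := hinjK (by rw [huX 1, huj1]; rfl)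
      exact ⟨c', hc', V, by rw [hcV, h0, h1], hV⟩
    · -- proportional consecutive vectors: the two points coincide
      obtain ⟨c₀, hc₀, hwc⟩ := exists_eq_smul_of_not_linearIndependent (hwZne _ (by omega))
        (hwZne _ (by omega)) hind
      have heq : pointOfVec Z.left.functionField (wZ j) (hwZne _ (by omega)) =
          pointOfVec Z.left.functionField (wZ ((j : ℕ) + 1)) (hwZne _ (by omega)) :=
        (pointOfVec_eq_pointOfVec_iff _ _ _ _).mpr ⟨c₀, hc₀, hwc⟩
      have hujj : u j = u ((j : ℕ) + 1) :=
        hinjK (by rw [huj, huj1]; exact congrArg AlgPoints.pt heq)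
      refine ⟨0, zero_mem _, 0, ?_, fun z hz0 => (hz0 rfl).elim⟩
      simp only [T, hujj, sub_self, add_zero]
  choose cf hcf Vf hcV hVf using hlinkrel
  -- telescoping
  have htel : ∑ j : Fin (r + 1), (T j - T ((j : ℕ) + 1)) = T 0 - T (r + 1) := by
    rw [Fin.sum_univ_eq_sum_range (fun n => T n - T (n + 1)) (r + 1)]
    exact Finset.sum_range_sub' T (r + 1)
  have hu0 : (iK N Z X i).base (u 0) = (pointOfVec Z.left.functionField pZ hpZ0).pt := by
    rw [hu 0]; congr 1; simp only [Nat.zero_min, hwZ0]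
  have hur : (iK N Z X i).base (u (r + 1)) = (pointOfVec Z.left.functionField qZ hqZ0).pt := by
    rw [hu (r + 1)]; congr 1; simp only [min_self, hwZr]
  obtain ⟨he, hMe⟩ := hMp (u 0) hu0
  -- the degree: `u 0` is the `K(Z)`-point `Spec K(Z) → Spec K → X`, of degree `[E : K]`
  have haZ : (Spec.map (CommRingCat.ofHom ψ.toRingHom) ≫ aW) ≫ X.hom = qgen Z ≫ Z.hom := by
    rw [Category.assoc, haW, qgen_comp_hom W, qgen_comp_hom Z, ← Spec.map_comp]
    congr 1
    rw [← CommRingCat.ofHom_comp]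
    congr 1
    exact ψ.comp_algebraMap
  have hu0X : u 0 = uXPt Z X _ haZ := by
    apply hinjK
    rw [hu0, iK_uXPt, ← pt_algPt]
    exact (congrArg AlgPoints.pt
      (algPt_specMap_comp_eq_pointOfVec N Z X i W aW haW ψ haZ p hp0 hPp.symm)).symm
  have haWsurj : ∀ x, Function.Surjective (aW.residueFieldMap x) := fun x =>
    residueFieldMap_qgen_curveOf_surjective z₀ x
  have he_eq : (CartesianMonoidalCategory.fst X Z).left.residueDegree ((ιX Z X).base (u 0)) =
      Module.finrank W.left.functionField (↥E) := by
    rw [hu0X]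
    refine (residueDegree_fst_uXPt_specMap_comp Z X W aW ψ haZ haWsurj).trans ?_
    letI := ψ.toRingHom.toAlgebra
    exact Algebra.finrank_eq_of_equiv_equiv (RingEquiv.refl _) θ
      (RingHom.ext fun x => (θ.apply_symm_apply _).symm)
  refine ⟨_, he, he_eq.trans_le hEle, ∑ j, cf j, sum_mem fun j _ => hcf j, ∑ j, Vf j, ?_,
    fun z hz' => ?_⟩
  · have hsum : ∑ j, cf j = (∑ j : Fin (r + 1), (T j - T ((j : ℕ) + 1))) + ∑ j, Vf j := by
      rw [← Finset.sum_add_distrib]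
      exact Finset.sum_congr rfl fun j _ => hcV j
    rw [hsum, htel, map_add, map_sub]
    change M (primeCycle _) - M (primeCycle _) + _ = _
    rw [hMe, hMq (u (r + 1)) hur, sub_zero]
  · have hz'' : (∑ j, Vf j) z ≠ 0 := hz'
    rw [Function.locallyFinsuppWithin.coe_sum, Finset.sum_apply] at hz''
    obtain ⟨j, -, hj⟩ := Finset.exists_ne_zero_of_sum_ne_zero hz''
    exact hVf j z hj


end MainBounded


end ProjFamily


/-! ## The uniform exponent and the reduction of the named fact to (D) + (G) -/

section Uniform

open ProjFamily

variable {k : Type u} [Field k] [IsAlgClosed k]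

/-- **A uniform positive integer multiplies `CH₁(X)` into the subgroup generated by the lines**
(the integer `N` of Kollár IV.3.13.3 / Tian–Zong Prop. 3.1, for chains of lines): for `X ⊆ ℙᴺ_k`
(`k` algebraically closed) a closed subscheme with underlying set `V₊(F₁, …, F_c)`, `Fₐ` forms of
degrees `dₐ ≥ 1` with `Σₐ dₐ + 1 ≤ N`, there is `Nu > 0` such that `Nu • x` lies in the subgroup
generated by the line classes for EVERY `x ∈ CH₁(X)` (`Nu = Bd!` for the bound `Bd` of
`exists_chain_finrank_bound`). [cite: TianZong2014, Prop. 3.1 and proof of Thm. 6.1] -/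
theorem exists_uniform_pos_smul_mem_closure_lineClasses_of_sum_deg_le {N : ℕ} {X : SchemeOver k}
    {c : ℕ} (F : Fin c → MvPolynomial (Fin (N + 1)) k) (d : Fin c → ℕ)
    (i : X ⟶ projectiveSpace N k) [IsClosedImmersion i.left]
    (hFhom : ∀ a, (F a).IsHomogeneous (d a)) (hd : ∀ a, 0 < d a) (hN : ∑ a, d a + 1 ≤ N)
    (hrange : Set.range i.left.base =
      ProjectiveSpectrum.zeroLocus (homogeneousSubmodule (Fin (N + 1)) k) (Set.range F)) :
    ∃ Nu : ℕ, 0 < Nu ∧ ∀ x : ChowGroup X.left 1,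
      (Nu : ℤ) • x ∈ AddSubgroup.closure (lineClasses N i) := by
  haveI : IsProper (projectiveSpace N k).hom := isProper_projectiveSpace N k
  haveI : IsProper X.hom := by rw [← Over.w i]; infer_instance
  haveI : CompactSpace ↥X.left := compactSpace_of_quasiCompact_hom X
  obtain ⟨Bd, hBd⟩ := Literature.RingTheory.MvPolynomial.exists_chain_finrank_bound F d hFhom hd hN
  refine ⟨Bd.factorial, Nat.factorial_pos Bd, fun x => ?_⟩
  suffices h : (AddSubgroup.closure (lineClasses N i)).comap
      (zsmulAddGroupHom (Bd.factorial : ℤ)) = ⊤ by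
    have hx : x ∈ (AddSubgroup.closure (lineClasses N i)).comap
        (zsmulAddGroupHom (Bd.factorial : ℤ)) := by
      rw [h]; exact AddSubgroup.mem_top x
    exact hx
  refine ChowGroup.eq_top_of_forall_ofPoint_mem fun z hz => ?_
  obtain ⟨e, he, hele, s, w, hs, hrat⟩ :=
    exists_le_smul_primeCycle_ratEquiv_lines_of_boundedChain X i (by omega) F d hFhom hd hrange Bd
      hBd z (by simpa using hz)
  rw [AddSubgroup.mem_comap]
  change ((Bd.factorial : ℕ) : ℤ) • ChowGroup.ofPoint z hz ∈ AddSubgroup.closure (lineClasses N i)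
  obtain ⟨m, hm⟩ := Nat.dvd_factorial he hele
  have hmk : (e : ℤ) • ChowGroup.ofPoint z hz =
      ChowGroup.mk X.left 1 ⟨_, sum_zsmul_primeCycle_mem_cyclesOfDim w hs⟩ := by
    rw [ChowGroup.ofPoint, ← map_zsmul]
    exact ChowGroup.mk_eq_mk_iff.mpr hrat
  rw [hm, Nat.cast_mul, mul_comm, mul_smul, hmk]
  exact AddSubgroup.zsmul_mem _ (mk_sum_zsmul_primeCycle_mem_closure_lineClasses w hs) _

/-- **`TianZong2014_chowOne_generatedByLines` up to a UNIFORM torsion exponent, in the binders of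
the named fact**: for a smooth complete intersection of the fact there is `Nu > 0` with
`Nu • CH₁(X) ⊆ ⟨line classes⟩` (the hypotheses `IsSmoothProjective`, `IsNonsingularSystem`,
`CharZero` are not needed and omitted). [cite: TianZong2014, Thm. 1.7, Prop. 3.1, proof of Thm. 6.1] -/
theorem TianZong2014_chowOne_generatedByLines_uniformTorsion {k : Type u} [Field k] [IsAlgClosed k]
    {c : ℕ} (n : ℕ) (d : Fin c → ℕ) {X : SchemeOver k}
    (F : Fin c → MvPolynomial (Fin (n + c + 1)) k) (i : X ⟶ projectiveSpace (n + c) k)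
    (hF : ∀ a, (F a).IsHomogeneous (d a)) (hd : ∀ a, 0 < d a) [IsClosedImmersion i.left]
    (hV : Set.range i.left.base =
      ProjectiveSpectrum.zeroLocus (MvPolynomial.homogeneousSubmodule (Fin (n + c + 1)) k)
        (Set.range F))
    (hdeg : (∑ a, d a) + 1 ≤ n + c) :
    ∃ Nu : ℕ, 0 < Nu ∧ ∀ x : ChowGroup X.left 1,
      (Nu : ℤ) • x ∈ AddSubgroup.closure (lineClasses (n + c) i) :=
  exists_uniform_pos_smul_mem_closure_lineClasses_of_sum_deg_le F d i hF hd hdeg hV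

/-- **Tian–Zong, proof of Thm. 6.1 after its two bullets: `CH₁(X)` is generated by lines as soon as
(D) the image of `Alg₁(X)` in `CH₁(X)` is divisible and (G) every curve is algebraically
equivalent to an integral combination of lines** — for every closed `X ⊆ ℙᴺ_k` with underlying
set `V₊(F)`, `Σ deg Fₐ + 1 ≤ N` (Lemma 3.4 `chowOneGeneratedByLines_of_algTrivial` with the
uniform exponent `exists_uniform_pos_smul_mem_closure_lineClasses_of_sum_deg_le`).
[cite: TianZong2014, Lemma 3.4 and proof of Thm. 6.1 (p. 9)] -/
theorem chowOneGeneratedByLines_of_algTrivial_of_sum_deg_le {N : ℕ} {X : SchemeOver k} {c : ℕ}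
    (F : Fin c → MvPolynomial (Fin (N + 1)) k) (d : Fin c → ℕ)
    (i : X ⟶ projectiveSpace N k) [IsClosedImmersion i.left]
    (hFhom : ∀ a, (F a).IsHomogeneous (d a)) (hd : ∀ a, 0 < d a) (hN : ∑ a, d a + 1 ≤ N)
    (hrange : Set.range i.left.base =
      ProjectiveSpectrum.zeroLocus (homogeneousSubmodule (Fin (N + 1)) k) (Set.range F))
    (hdiv : ∀ a ∈ algTrivial X 1, ∀ m : ℕ, 0 < m →
      ∃ b ∈ algTrivial X 1, IsRationallyEquivalent a ((m : ℤ) • b) 1)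
    (hgen : ∀ z : ↥X.left, height z = 1 → ∃ (s : Finset ↥X.left) (w : ↥X.left → ℤ),
      (∀ y ∈ s, IsLinePoint N i y) ∧
        primeCycle z - ∑ y ∈ s, w y • primeCycle y ∈ algTrivial X 1) :
    ChowOneGeneratedByLines N i := by
  haveI : IsProper (projectiveSpace N k).hom := isProper_projectiveSpace N k
  haveI : IsProper X.hom := by rw [← Over.w i]; infer_instance
  haveI : CompactSpace ↥X.left := compactSpace_of_quasiCompact_hom X
  exact chowOneGeneratedByLines_of_algTrivial
    (exists_uniform_pos_smul_mem_closure_lineClasses_of_sum_deg_le F d i hFhom hd hN hrange) hdiv hgen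

/-- **The named fact `TianZong2014_chowOne_generatedByLines` follows from (D) and (G) alone**: if
for every smooth complete intersection `X ⊆ ℙⁿ⁺ᶜ_k` of the fact (D) the image of `Alg₁(X)` in
`CH₁(X)` is divisible (Tian–Zong Lemma 3.2 = Bloch–Ogus, Lemma 7.10) and (G) every integral curve
is algebraically equivalent to an integral combination of lines (Tian–Zong Thm. 1.3 with Thm. 6.2),
then the fact holds — the rational chain connectedness by lines (Kollár V.4.8.1), the surjectivity
of `CH₀(F(X)) ⊗ ℚ → CH₁(X) ⊗ ℚ` (Kollár IV.3.13.3) and the UNIFORM integer `N` of Prop. 3.1 being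
proved in the tree. [cite: TianZong2014, proof of Thm. 6.1 (p. 9), Lemma 3.4] -/
theorem TianZong2014_chowOne_generatedByLines_of_divisible_of_algEquiv
    (h : ∀ ⦃k : Type u⦄ [Field k] [IsAlgClosed k] [CharZero k] ⦃c : ℕ⦄ (n : ℕ) (d : Fin c → ℕ)
      ⦃X : SchemeOver k⦄ (F : Fin c → MvPolynomial (Fin (n + c + 1)) k)
      (i : X ⟶ projectiveSpace (n + c) k),
      IsSmoothProjective n X → (∀ a, (F a).IsHomogeneous (d a)) → (∀ a, 0 < d a) →
        IsNonsingularSystem k F → IsClosedImmersion i.left →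
          Set.range i.left.base =
            ProjectiveSpectrum.zeroLocus (MvPolynomial.homogeneousSubmodule (Fin (n + c + 1)) k)
              (Set.range F) →
            (∑ a, d a) + 1 ≤ n + c →
              (∀ a ∈ algTrivial X 1, ∀ m : ℕ, 0 < m →
                ∃ b ∈ algTrivial X 1, IsRationallyEquivalent a ((m : ℤ) • b) 1) ∧
              (∀ z : ↥X.left, height z = 1 → ∃ (s : Finset ↥X.left) (w : ↥X.left → ℤ),
                (∀ y ∈ s, IsLinePoint (n + c) i y) ∧
                  primeCycle z - ∑ y ∈ s, w y • primeCycle y ∈ algTrivial X 1)) :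
    TianZong2014_chowOne_generatedByLines.{u} := by
  refine TianZong2014_chowOne_generatedByLines_of_algTrivial
    fun k _ _ _ c n d X F i hX hF hd hJ hi hV hdeg => ⟨?_, (h n d F i hX hF hd hJ hi hV hdeg).1,
      (h n d F i hX hF hd hJ hi hV hdeg).2⟩
  haveI := hi
  exact exists_uniform_pos_smul_mem_closure_lineClasses_of_sum_deg_le F d i hF hd hdeg hV

end Uniform

end Literature.AlgebraicGeometry.Motives

end
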